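import Summits.CriticalPhenomena.SAWScalingLimit.Theorems.MassRatio.Negative.RowsB

/-!
# Crux `MassRatio` (stmt-CriticalPhenomena-8550) — load-bearing hypotheses, part 7: the root-attached fjord family `Λ₂` (rows `[m+3,M]` ∪ staircase ∪ bare corridor along row `m` to the tip `b₂ → 1-i`): membership, simple connectivity, connectedness, boundary edges, the corridor is bare, **`norm_Z_b₂ : |Z(b₂)| = x_c^{L₂+1}`**

Negative knowledge on the crux `MassRatio` (stmt-CriticalPhenomena-8550, route SAWDefectDecoherence r3),
written by the standing disprover (cdisprove, cycles 1–4). The series `MassRatio/Negative/*` does NOT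
refute the crux (verdict: RESISTS — it is a pure exponent bet, predicted ratio `δ^{-25/48}` against the
cut `δ^{-3/4}`); it proves which hypotheses of the crux are LOAD-BEARING (rows clause, `0 < ρ`,
`δ·mid(b_δ) → b`, exhaustion of compacts: each deleted ⇒ FALSE, by explicit admissible families in the
rectangle `D₀ = (-2,2)×(-1,1)` whose boundary mass at the target edge is starved EXACTLY by a bare
corridor), that the hypothesis frame is satisfiable (`massRatio_frame_nonvacuous`), and that the
`Nonempty`-SAW clause is implied by the others. Mechanism throughout: on a bare root-attached corridor
the self-avoiding walk is unique, so `|Z| = x_c^{length}` exactly, while a staircase walk certifies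
`|Z(e₀)| ≥ x_c^{2 iK + 1}` at a mid-edge `e₀` of the compact `Kbox`; `x_c < 3/5` and Bernoulli finish.
-/

namespace Summit.CriticalPhenomena.SAWScalingLimit.Theorems.MassRatio.Negative

open Literature.Probability.LatticeModels Literature.Probability.RandomPlanarGeometry.SAW
open Literature.Probability.RandomPlanarGeometry
open Summit.CriticalPhenomena.SAWScalingLimit.Theses.SAWDefectDecoherence

/-! ## §G. The root-attached fjord family `Λ₂`: the rows clause (equivalently `0 < ρ`) is load-bearing

`Λ₂(δ)` = the rows `[m+3, M]` of the rectangle, plus a six-vertex staircase from the root vertex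
`(m, pA)` up to row `m+3`, plus a bare corridor along the bottom row `m` from `(m, pA+1)` to
`(m, pB-1)`; the marked boundary mid-edge is the corridor TIP `b'_δ = {(m,pB-1),(m,pB)}`, which still
converges to `b = 1 - i`. Every walk from `a_δ` to the tip is the corridor itself, so
`Z_δ(b'_δ) = x_c^{L+1}` with `L + 1 = pB - pA ≈ 4/δ`, while the staircase walk reaches the compact box
`Kbox` after `2 iK + 1 ≈ 0.92/δ` vertices. -/

/-- the test compact: the box `[-7/4, -1] × [-7/8, -1/4] ⊂ D₀` [folklore] -/
def Kbox : Set ℂ := Set.Icc (-7 / 4 : ℝ) (-1) ×ℂ Set.Icc (-7 / 8 : ℝ) (-1 / 4)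

/-- `Kbox_compact`: fjord-family (`Λ₂`) lemma (MassRatio negative series). [folklore] -/
theorem Kbox_compact : IsCompact Kbox := isCompact_Icc.reProdIm isCompact_Icc

/-- `Kbox_sub`: fjord-family (`Λ₂`) lemma (MassRatio negative series). [folklore] -/
theorem Kbox_sub : Kbox ⊆ D₀.carrier := by
  intro z hz
  rw [Kbox, Complex.mem_reProdIm, Set.mem_Icc, Set.mem_Icc] at hz
  rw [mem_D₀_carrier]
  refine ⟨⟨by linarith [hz.1.1], by linarith [hz.1.2]⟩, by linarith [hz.2.1], by linarith [hz.2.2]⟩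

/-- `mem_Kbox`: fjord-family (`Λ₂`) lemma (MassRatio negative series). [folklore] -/
theorem mem_Kbox {z : ℂ} : z ∈ Kbox ↔ (-7 / 4 ≤ z.re ∧ z.re ≤ -1) ∧ (-7 / 8 ≤ z.im ∧ z.im ≤ -1 / 4) := by
  rw [Kbox, Complex.mem_reProdIm, Set.mem_Icc, Set.mem_Icc]

/-- **The fjord family** (filter of the big rectangle by a coordinate predicate). [folklore] -/
noncomputable def Λ₂ (δ : ℝ) : Finset HexVertex := by
  classical exact (Rect (mRow δ) (MRow δ) (-PPos δ) (PPos δ)).filter fun v =>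
    (mRow δ + 3 ≤ row v ∧ row v ≤ MRow δ ∧ -PPos δ ≤ pos v ∧ pos v ≤ PPos δ) ∨
    (row v = mRow δ ∧ pA δ - 1 ≤ pos v ∧ pos v ≤ pB δ - 1) ∨
    (row v = mRow δ + 1 ∧ (pos v = pA δ - 1 ∨ pos v = pA δ - 2)) ∨
    (row v = mRow δ + 2 ∧ (pos v = pA δ - 2 ∨ pos v = pA δ - 3))

/-- the corridor tip `b'_δ = {(m, pB-1), (m, pB)}` [folklore] -/
noncomputable def b₂ (δ : ℝ) : Sym2 HexVertex := s(bv (mRow δ) (pB δ - 1), bv (mRow δ) (pB δ))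

/-- the staircase `S_j`: `S_{2i} = (m+i, pA-i)`, `S_{2i+1} = (m+i, pA-i-1)` [folklore] -/
noncomputable def stair (δ : ℝ) (j : ℕ) : HexVertex :=
  bv (mRow δ + ((j / 2 : ℕ) : ℤ)) (pA δ - (((j + 1) / 2 : ℕ) : ℤ))

section FjordFamily

variable {δ : ℝ}

/-- `Λ₂_subset`: fjord-family (`Λ₂`) lemma (MassRatio negative series). [folklore] -/
theorem Λ₂_subset (δ : ℝ) : Λ₂ δ ⊆ ΛR δ := by
  unfold Λ₂ ΛR; exact Finset.filter_subset _ _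

/-- `bv_mem_Λ₂`: fjord-family (`Λ₂`) lemma (MassRatio negative series). [folklore] -/
theorem bv_mem_Λ₂ (hδ : 0 < δ) (hδ1 : δ ≤ 1 / 100) {r p : ℤ} :
    bv r p ∈ Λ₂ δ ↔
      (mRow δ + 3 ≤ r ∧ r ≤ MRow δ ∧ -PPos δ ≤ p ∧ p ≤ PPos δ) ∨
      (r = mRow δ ∧ pA δ - 1 ≤ p ∧ p ≤ pB δ - 1) ∨
      (r = mRow δ + 1 ∧ (p = pA δ - 1 ∨ p = pA δ - 2)) ∨
      (r = mRow δ + 2 ∧ (p = pA δ - 2 ∨ p = pA δ - 3)) := by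
  obtain ⟨h1, h2, h3, h4, h5, h6, h7, h8, -⟩ := params hδ hδ1
  unfold Λ₂
  rw [Finset.mem_filter, bv_mem_Rect, row_bv, pos_bv]
  constructor
  · exact fun h => h.2
  · intro h; refine ⟨?_, h⟩; omega

/-- `bv_mem_compl_Λ₂`: fjord-family (`Λ₂`) lemma (MassRatio negative series). [folklore] -/
theorem bv_mem_compl_Λ₂ (hδ : 0 < δ) (hδ1 : δ ≤ 1 / 100) {r p : ℤ}
    (h : ¬ ((mRow δ + 3 ≤ r ∧ r ≤ MRow δ ∧ -PPos δ ≤ p ∧ p ≤ PPos δ) ∨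
      (r = mRow δ ∧ pA δ - 1 ≤ p ∧ p ≤ pB δ - 1) ∨
      (r = mRow δ + 1 ∧ (p = pA δ - 1 ∨ p = pA δ - 2)) ∨
      (r = mRow δ + 2 ∧ (p = pA δ - 2 ∨ p = pA δ - 3)))) :
    bv r p ∈ ((↑(Λ₂ δ) : Set HexVertex))ᶜ := by
  rw [Set.mem_compl_iff, Finset.mem_coe, bv_mem_Λ₂ hδ hδ1]; exact h

/-- The complement of `Λ₂` is connected: every vertex off `Λ₂` is linked to `(m-1, -P-3)`. [folklore] -/
theorem linked_compl_Λ₂ (hδ : 0 < δ) (hδ1 : δ ≤ 1 / 100) {v : HexVertex} (hv : v ∉ Λ₂ δ) :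
    Linked ((↑(Λ₂ δ) : Set HexVertex))ᶜ v (bv (mRow δ - 1) (-PPos δ - 3)) := by
  obtain ⟨hiM, hM0, hm10, hPa, hpa, hpb, hbP, hP100, -⟩ := params hδ hδ1
  set m := mRow δ with hm
  set M := MRow δ with hM
  set P := PPos δ with hP
  have hv' : v = bv (row v) (pos v) := (bv_row_pos v).symm
  set r := row v with hr
  set p := pos v with hp
  rw [hv'] at hv ⊢
  rw [bv_mem_Λ₂ hδ hδ1] at hv
  set C := ((↑(Λ₂ δ) : Set HexVertex))ᶜ with hC
  have nm : ∀ r' p' : ℤ, ¬ ((m + 3 ≤ r' ∧ r' ≤ M ∧ -P ≤ p' ∧ p' ≤ P) ∨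
      (r' = m ∧ pA δ - 1 ≤ p' ∧ p' ≤ pB δ - 1) ∨
      (r' = m + 1 ∧ (p' = pA δ - 1 ∨ p' = pA δ - 2)) ∨
      (r' = m + 2 ∧ (p' = pA δ - 2 ∨ p' = pA δ - 3))) → bv r' p' ∈ C :=
    fun r' p' h => bv_mem_compl_Λ₂ hδ hδ1 h
  -- the two funnels
  have bandL : ∀ r' : ℤ, Linked C (bv r' (-P - 3)) (bv (m - 1) (-P - 3)) := by
    intro r'
    rcases le_or_gt r' (m - 1) with h | h
    · exact (linked_band (-P - 3) r' (m - 1) h fun r'' _ _ =>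
        ⟨nm _ _ (by omega), by have := nm r'' (-P - 3 + 1) (by omega); exact this⟩).symm
    · exact linked_band (-P - 3) (m - 1) r' h.le fun r'' _ _ =>
        ⟨nm _ _ (by omega), by have := nm r'' (-P - 3 + 1) (by omega); exact this⟩
  have routeL : ∀ r' p' : ℤ, (∀ t, min p' (-P - 3) ≤ t → t ≤ max p' (-P - 3) →
      bv r' t ∈ C) → Linked C (bv r' p') (bv (m - 1) (-P - 3)) := by
    intro r' p' hfree
    have step1 : Linked C (bv r' p') (bv r' (-P - 3)) := by
      rcases le_or_gt p' (-P - 3) with h | h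
      · exact linked_run' r' p' (-P - 3) h fun t h1 h2 => hfree t (by omega) (by omega)
      · exact (linked_run' r' (-P - 3) p' h.le fun t h1 h2 => hfree t (by omega) (by omega)).symm
    exact step1.trans (bandL r')
  have routeR : ∀ r' p' : ℤ, m - 1 ≤ r' → (∀ t, min p' (P + 2) ≤ t → t ≤ max p' (P + 2) →
      bv r' t ∈ C) → Linked C (bv r' p') (bv (m - 1) (-P - 3)) := by
    intro r' p' hr' hfree
    have step1 : Linked C (bv r' p') (bv r' (P + 2)) := by
      rcases le_or_gt p' (P + 2) with h | h
      · exact linked_run' r' p' (P + 2) h fun t h1 h2 => hfree t (by omega) (by omega)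
      · exact (linked_run' r' (P + 2) p' h.le fun t h1 h2 => hfree t (by omega) (by omega)).symm
    have step2 : Linked C (bv r' (P + 2)) (bv (m - 1) (P + 2)) :=
      linked_band (P + 2) (m - 1) r' hr' fun r'' _ _ =>
        ⟨nm _ _ (by omega), by have := nm r'' (P + 2 + 1) (by omega); exact this⟩
    have step3 : Linked C (bv (m - 1) (P + 2)) (bv (m - 1) (-P - 3)) :=
      (linked_run' (m - 1) (-P - 3) (P + 2) (by omega) fun t _ _ => nm _ _ (by omega)).symm
    exact (step1.trans step2).trans step3
  -- case analysis on the row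
  by_cases hfree : r ≤ m - 1 ∨ M + 1 ≤ r
  · exact routeL r p fun t _ _ => nm _ _ (by omega)
  by_cases hrm : r = m
  · by_cases hpl : p ≤ pA δ - 2
    · exact routeL r p fun t h1 h2 => nm _ _ (by omega)
    · exact routeR r p (by omega) fun t h1 h2 => nm _ _ (by omega)
  by_cases hrm1 : r = m + 1
  · by_cases hpl : p ≤ pA δ - 3
    · exact routeL r p fun t h1 h2 => nm _ _ (by omega)
    · exact routeR r p (by omega) fun t h1 h2 => nm _ _ (by omega)
  by_cases hrm2 : r = m + 2
  · by_cases hpl : p ≤ pA δ - 4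
    · exact routeL r p fun t h1 h2 => nm _ _ (by omega)
    · exact routeR r p (by omega) fun t h1 h2 => nm _ _ (by omega)
  -- rows `m+3 … M`: the position is out of range
  by_cases hpl : p < -P
  · exact routeL r p fun t h1 h2 => nm _ _ (by omega)
  · exact routeR r p (by omega) fun t h1 h2 => nm _ _ (by omega)

/-- `simplyConnected_Λ₂`: fjord-family (`Λ₂`) lemma (MassRatio negative series). [folklore] -/
theorem simplyConnected_Λ₂ (hδ : 0 < δ) (hδ1 : δ ≤ 1 / 100) : hexDomainSimplyConnected (Λ₂ δ) :=
  preconnected_of_linked fun _ hu _ hv =>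
    (linked_compl_Λ₂ hδ hδ1 (fun h => hu h)).trans (linked_compl_Λ₂ hδ hδ1 (fun h => hv h)).symm

/-- `Λ₂` is connected: every vertex is linked inside `Λ₂` to `(M, 0)`. [folklore] -/
theorem linked_Λ₂ (hδ : 0 < δ) (hδ1 : δ ≤ 1 / 100) {v : HexVertex} (hv : v ∈ Λ₂ δ) :
    Linked (↑(Λ₂ δ) : Set HexVertex) v (bv (MRow δ) 0) := by
  obtain ⟨hiM, hM0, hm10, hPa, hpa, hpb, hbP, hP100, -⟩ := params hδ hδ1
  have hmod := pA_mod δ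
  set m := mRow δ with hm
  set M := MRow δ with hM
  set P := PPos δ with hP
  have hv' : v = bv (row v) (pos v) := (bv_row_pos v).symm
  set r := row v
  set p := pos v
  rw [hv'] at hv ⊢
  rw [bv_mem_Λ₂ hδ hδ1] at hv
  set C := (↑(Λ₂ δ) : Set HexVertex) with hC
  have mm : ∀ r' p' : ℤ, ((m + 3 ≤ r' ∧ r' ≤ M ∧ -P ≤ p' ∧ p' ≤ P) ∨
      (r' = m ∧ pA δ - 1 ≤ p' ∧ p' ≤ pB δ - 1) ∨
      (r' = m + 1 ∧ (p' = pA δ - 1 ∨ p' = pA δ - 2)) ∨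
      (r' = m + 2 ∧ (p' = pA δ - 2 ∨ p' = pA δ - 3))) → bv r' p' ∈ C := fun r' p' h => by
    rw [hC, Finset.mem_coe, bv_mem_Λ₂ hδ hδ1]; exact h
  -- the bulk route
  have bulk : ∀ r' p' : ℤ, m + 3 ≤ r' → r' ≤ M → -P ≤ p' → p' ≤ P →
      Linked C (bv r' p') (bv M 0) := by
    intro r' p' h1 h2 h3 h4
    have step1 : Linked C (bv r' p') (bv r' 0) := by
      rcases le_or_gt p' 0 with h | h
      · exact linked_run' r' p' 0 h fun t _ _ => mm _ _ (by omega)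
      · exact (linked_run' r' 0 p' h.le fun t _ _ => mm _ _ (by omega)).symm
    exact step1.trans (linked_band 0 r' M h2 fun r'' _ _ => ⟨mm _ _ (by omega), mm _ _ (by omega)⟩).symm
  -- the staircase, linked step by step up to `(m+3, pA-3)`
  have a1 : Linked C (bv m (pA δ - 1)) (bv (m + 1) (pA δ - 1)) :=
    linked_of_adj (mm _ _ (by omega)) (mm _ _ (by omega))
      (by rw [adj_bv_iff]; right; right; exact ⟨rfl, rfl, by omega⟩)
  have a2 : Linked C (bv (m + 1) (pA δ - 1)) (bv (m + 1) (pA δ - 2)) :=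
    linked_of_adj (mm _ _ (by omega)) (mm _ _ (by omega))
      (by rw [adj_bv_iff]; left; exact ⟨rfl, Or.inr (by ring)⟩)
  have a3 : Linked C (bv (m + 1) (pA δ - 2)) (bv (m + 2) (pA δ - 2)) :=
    linked_of_adj (mm _ _ (by omega)) (mm _ _ (by omega))
      (by rw [adj_bv_iff]; right; right; exact ⟨rfl, by ring, by omega⟩)
  have a4 : Linked C (bv (m + 2) (pA δ - 2)) (bv (m + 2) (pA δ - 3)) :=
    linked_of_adj (mm _ _ (by omega)) (mm _ _ (by omega))
      (by rw [adj_bv_iff]; left; exact ⟨rfl, Or.inr (by ring)⟩)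
  have a5 : Linked C (bv (m + 2) (pA δ - 3)) (bv (m + 3) (pA δ - 3)) :=
    linked_of_adj (mm _ _ (by omega)) (mm _ _ (by omega))
      (by rw [adj_bv_iff]; right; right; exact ⟨rfl, by ring, by omega⟩)
  have top : Linked C (bv (m + 3) (pA δ - 3)) (bv M 0) := bulk _ _ (by omega) (by omega) (by omega) (by omega)
  have s5 := a5.trans top
  have s4 := a4.trans s5
  have s3 := a3.trans s4
  have s2 := a2.trans s3
  have s1 := a1.trans s2
  rcases hv with h | ⟨hr, hp1, hp2⟩ | ⟨hr, hp | hp⟩ | ⟨hr, hp | hp⟩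
  · exact bulk r p h.1 h.2.1 h.2.2.1 h.2.2.2
  · -- the bottom row: run left to `(m, pA-1)`
    have run : Linked C (bv r p) (bv m (pA δ - 1)) := by
      rw [hr]
      exact (linked_run' m (pA δ - 1) p hp1 fun t _ _ => mm _ _ (by omega)).symm
    exact run.trans s1
  · rw [hr, hp]; exact s2
  · rw [hr, hp]; exact s3
  · rw [hr, hp]; exact s4
  · rw [hr, hp]; exact s5

/-- `preconnected_Λ₂`: fjord-family (`Λ₂`) lemma (MassRatio negative series). [folklore] -/
theorem preconnected_Λ₂ (hδ : 0 < δ) (hδ1 : δ ≤ 1 / 100) :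
    (hexGraph.induce ((Λ₂ δ : Finset HexVertex) : Set HexVertex)).Preconnected :=
  preconnected_of_linked fun _ hu _ hv =>
    (linked_Λ₂ hδ hδ1 hu).trans (linked_Λ₂ hδ hδ1 hv).symm

/-- `aE_mem_boundary₂`: fjord-family (`Λ₂`) lemma (MassRatio negative series). [folklore] -/
theorem aE_mem_boundary₂ (hδ : 0 < δ) (hδ1 : δ ≤ 1 / 100) : aE δ ∈ hexDomainBoundary (Λ₂ δ) := by
  obtain ⟨-, hM0, hm10, hPa, hpa, hpb, -, hP100, -⟩ := params hδ hδ1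
  refine ⟨(SimpleGraph.mem_edgeSet _).2 (adj_aE δ), bv (mRow δ - 1) (pA δ), bv (mRow δ) (pA δ),
    rfl, ?_, ?_⟩
  · rw [bv_mem_Λ₂ hδ hδ1]; omega
  · rw [bv_mem_Λ₂ hδ hδ1]; omega

/-- `adj_b₂`: fjord-family (`Λ₂`) lemma (MassRatio negative series). [folklore] -/
theorem adj_b₂ (δ : ℝ) : hexGraph.Adj (bv (mRow δ) (pB δ - 1)) (bv (mRow δ) (pB δ)) := by
  rw [adj_bv_iff]; left; exact ⟨rfl, Or.inl (by ring)⟩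

/-- `b₂_mem_boundary`: fjord-family (`Λ₂`) lemma (MassRatio negative series). [folklore] -/
theorem b₂_mem_boundary (hδ : 0 < δ) (hδ1 : δ ≤ 1 / 100) : b₂ δ ∈ hexDomainBoundary (Λ₂ δ) := by
  obtain ⟨-, hM0, hm10, hPa, hpa, hpb, hbP, hP100, -⟩ := params hδ hδ1
  refine ⟨(SimpleGraph.mem_edgeSet _).2 (adj_b₂ δ), bv (mRow δ) (pB δ), bv (mRow δ) (pB δ - 1),
    Sym2.eq_swap, ?_, ?_⟩
  · rw [bv_mem_Λ₂ hδ hδ1]; omega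
  · rw [bv_mem_Λ₂ hδ hδ1]; omega

/-- the corridor `c_i = (m, pA + i)`, `i = 0 … L₂`, `L₂ = pB - pA - 1` [folklore] -/
noncomputable def corr (δ : ℝ) (i : ℕ) : HexVertex := bv (mRow δ) (pA δ + i)

/-- corridor length of the fjord family [folklore] -/
noncomputable def L₂ (δ : ℝ) : ℕ := (pB δ - 1 - pA δ).toNat

/-- `L₂_eq`: fjord-family (`Λ₂`) lemma (MassRatio negative series). [folklore] -/
theorem L₂_eq (hδ : 0 < δ) (hδ1 : δ ≤ 1 / 100) : (L₂ δ : ℤ) = pB δ - 1 - pA δ := by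
  obtain ⟨-, -, -, -, hpa, hpb, -⟩ := params hδ hδ1
  unfold L₂; omega

/-- `aE_eq`: fjord-family (`Λ₂`) lemma (MassRatio negative series). [folklore] -/
theorem aE_eq (δ : ℝ) : aE δ = s(bv (mRow δ - 1) (pA δ), corr δ 0) := by simp [aE, corr]

/-- `b₂_eq`: fjord-family (`Λ₂`) lemma (MassRatio negative series). [folklore] -/
theorem b₂_eq (hδ : 0 < δ) (hδ1 : δ ≤ 1 / 100) : b₂ δ = s(corr δ (L₂ δ), bv (mRow δ) (pB δ)) := by
  have h := L₂_eq hδ hδ1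
  simp only [b₂, corr, h]; congr 2; ring

/-- The corridor data of `Λ₂` satisfy the hypotheses of the uniqueness lemma. [folklore] -/
theorem corr_bare (hδ : 0 < δ) (hδ1 : δ ≤ 1 / 100) :
    ∀ i, 1 ≤ i → i ≤ L₂ δ → ∀ v ∈ Λ₂ δ, hexGraph.Adj (corr δ i) v →
      v = corr δ (i - 1) ∨ (i < L₂ δ ∧ v = corr δ (i + 1)) := by
  obtain ⟨-, hM0, hm10, hPa, hpa, hpb, hbP, hP100, -⟩ := params hδ hδ1
  have hL := L₂_eq hδ hδ1
  intro i hi1 hi2 v hv hadj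
  have hv' : v = bv (row v) (pos v) := (bv_row_pos v).symm
  rw [hv'] at hv hadj ⊢
  rw [bv_mem_Λ₂ hδ hδ1] at hv
  unfold corr at hadj ⊢
  rw [adj_bv_iff] at hadj
  have hi1' : ((i - 1 : ℕ) : ℤ) = (i : ℤ) - 1 := by omega
  rcases hadj with ⟨h1, h2 | h2⟩ | ⟨h1, h2, -⟩ | ⟨h1, h2, -⟩
  · -- the next corridor vertex (or the excluded far end)
    right
    refine ⟨by omega, ?_⟩
    rw [← h1, h2]; congr 1; push_cast; ring
  · left
    rw [← h1, h2, hi1']; congr 1; ring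
  · exfalso; omega
  · exfalso; omega

/-- **`Z_δ(b'_δ) = x_c^{L₂+1}` exactly** (fjord starvation at the tip). [folklore] -/
theorem norm_Z_b₂ (hδ : 0 < δ) (hδ1 : δ ≤ 1 / 100) :
    ‖hexParafermionicObservable (Λ₂ δ) (aE δ) hexCriticalFugacity 0 (b₂ δ)‖ =
      hexCriticalFugacity ^ (L₂ δ + 1) := by
  obtain ⟨-, hM0, hm10, hPa, hpa, hpb, hbP, hP100, -⟩ := params hδ hδ1
  have hL := L₂_eq hδ hδ1
  rw [aE_eq, b₂_eq hδ hδ1]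
  refine norm_Z_corridor_tip (Λ := Λ₂ δ) (c := corr δ) (L := L₂ δ) ?_ ?_ ?_ ?_ ?_ ?_
    (corr_bare hδ hδ1) ?_ hexCriticalFugacity_pos_lt_one.1.le
  · intro i hi; unfold corr; rw [bv_mem_Λ₂ hδ hδ1]; omega
  · intro i j _ _ h; unfold corr at h; have := (bv_inj h).2; omega
  · intro i _; unfold corr; rw [adj_bv_iff]; left; exact ⟨rfl, Or.inl (by push_cast; ring)⟩
  · unfold corr; simpa using adj_aE δ
  · rw [bv_mem_Λ₂ hδ hδ1]; omega
  · rw [bv_mem_Λ₂ hδ hδ1]; omega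
  · intro h
    unfold corr at h
    rcases Sym2.eq_iff.1 h with ⟨h1, -⟩ | ⟨h1, -⟩
    · have := (bv_inj h1).1; omega
    · have := (bv_inj h1).1; omega

end FjordFamily

end Summit.CriticalPhenomena.SAWScalingLimit.Theorems.MassRatio.Negative
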